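import Mathlib
import Literature.NumberTheory.LFunctions.MertensFormula
import Literature.NumberTheory.LFunctions.MertensElementary
import Literature.NumberTheory.Sieve.PolynomialCongruencesMeanValues
import HarnessLib

/-!
# Crux `SystemMomentDeficit` (stmt-Parity-11326), line `Ideator3Sketch`: `stub_primePairTail`

Stub S2 (prime-pair tail) of the line skeleton
`Summit.Parity.BatemanHorn.Cruxes.SystemMomentDeficit.Ideator3Sketch` for the crux
`Summit.Parity.BatemanHorn.Theses.AlmostPrimeZeros.SystemMomentDeficit`.

With `PP(z)` the prime powers `p ≤ z` and `p² ≤ z`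
(`Nat.primesLE z ∪ (p ↦ p²) '' {p ≤ z prime : p² ≤ z}`), the harmonic mass of the region beyond
the hyperbola `qq' = x` is bounded:
`Σ_{q ∈ PP(⌊√x⌋)} Σ_{q' ∈ PP(x), qq' > x} 1/(qq') ≤ 596` for all `x ≥ 2`.

Proof.  Split `q'` into primes and prime squares (all terms are nonnegative, so the sum over a
union is at most the sum of the two sums).
* `q'` a prime square: every term is `≤ 1/x` (`qq' > x`) and there are at most
  `#PP(⌊√x⌋) · #{p : p² ≤ x} ≤ 2(⌊√x⌋ + 1)²  ≤ 8x` terms: contribution `≤ 8`.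
* `q'` prime: for `q ∈ PP(⌊√x⌋)` one has `2 ≤ q`, `q² ≤ x`, and the Mertens window
  `Σ_{x/q < p' ≤ x} 1/p' ≤ log log x − log log (x/q) + 16/log (x/q)`
  (`Literature.NumberTheory.Sieve.sum_inv_primes_Ioc_le`, i.e. Mertens' second theorem with rate)
  is `≤ (2 log q + 32)/log x` (`log (x/q) ≥ (log x)/2`, `log t ≤ t − 1`).  The weight
  `h(q) = (2 log q + 32)/(q log x)` satisfies `h(p²) ≤ h(p)`, so
  `Σ_{q ∈ PP(⌊√x⌋)} h(q) ≤ 2 Σ_{p ≤ √x} h(p) ≤ 2 · 294` by the upper halves of Mertens' first and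
  second theorems (`MertensBound.sum_log_div_prime_le`, `MertensBound.sum_inv_prime_le`).
Everything is [folklore]; no definitions are introduced.
-/

namespace Summit.Parity.BatemanHorn.Cruxes.SystemMomentDeficit.Ideator3Sketch

open Finset

/-- For nonnegative `f`, the sum over a union is at most the sum of the two sums. [folklore] -/
private theorem sum_union_le_add {s t : Finset ℕ} {f : ℕ → ℝ} (hf : ∀ i, 0 ≤ f i) :
    ∑ i ∈ s ∪ t, f i ≤ ∑ i ∈ s, f i + ∑ i ∈ t, f i := by
  have h := Finset.sum_union_inter (s₁ := s) (s₂ := t) (f := f)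
  have h0 : 0 ≤ ∑ i ∈ s ∩ t, f i := Finset.sum_nonneg fun i _ => hf i
  linarith

/-- The real inequality behind the window bound: for `0 ≤ l`, `2l ≤ L`, `0 < L`,
`log L − log (L − l) + 16/(L − l) ≤ (2l + 32)/L` (`log t ≤ t − 1` at `t = L/(L − l)` and
`L − l ≥ L/2`). [folklore] -/
private theorem log_sub_log_add_div_le {l L : ℝ} (hl : 0 ≤ l) (hlL : 2 * l ≤ L) (hL : 0 < L) :
    Real.log L - Real.log (L - l) + 16 / (L - l) ≤ (2 * l + 32) / L := by
  have hLl : 0 < L - l := by linarith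
  have h2 : L / 2 ≤ L - l := by linarith
  have hL2 : 0 < L / 2 := by linarith
  have h1 : Real.log L - Real.log (L - l) ≤ l / (L - l) := by
    rw [← Real.log_div hL.ne' hLl.ne']
    refine (Real.log_le_sub_one_of_pos (div_pos hL hLl)).trans_eq ?_
    rw [div_sub_one hLl.ne']
    ring
  calc Real.log L - Real.log (L - l) + 16 / (L - l)
      ≤ l / (L - l) + 16 / (L - l) := by linarith
    _ = (l + 16) / (L - l) := (add_div _ _ _).symm
    _ ≤ (l + 16) / (L / 2) := div_le_div_of_nonneg_left (by linarith) hL2 h2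
    _ = (2 * l + 32) / L := by
        field_simp
        ring

/-- Mertens window beyond the hyperbola: for naturals `2 ≤ q`, `q² ≤ x`,
`Σ_{p ≤ x prime, qp > x} 1/p ≤ (2 log q + 32)/log x`
(`Literature.NumberTheory.Sieve.sum_inv_primes_Ioc_le` at `X = x/q ≥ √x ≥ 2`, `y = x`). [folklore] -/
private theorem sum_inv_primes_window_le {x q : ℕ} (hq : 2 ≤ q) (hqx : q * q ≤ x) :
    ∑ p ∈ (Nat.primesLE x).filter (fun p => x < q * p), (p : ℝ)⁻¹ ≤
      (2 * Real.log q + 32) / Real.log x := by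
  have hq0 : (0 : ℝ) < q := by exact_mod_cast (show 0 < q by omega)
  have hx1 : 1 < x := by nlinarith
  have hx0 : (0 : ℝ) < x := by exact_mod_cast (show 0 < x by omega)
  have hX : (2 : ℝ) ≤ (x : ℝ) / q := by
    rw [le_div_iff₀ hq0]
    have h2q : 2 * q ≤ x := by nlinarith
    exact_mod_cast h2q
  have hXy : (x : ℝ) / q ≤ x := div_le_self hx0.le (by exact_mod_cast (show 1 ≤ q by omega))
  have h := Literature.NumberTheory.Sieve.sum_inv_primes_Ioc_le hX hXy
  rw [Nat.floor_natCast] at h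
  have hset : (Nat.primesLE x).filter (fun p => x < q * p) =
      (Nat.primesLE x).filter (fun p : ℕ => (x : ℝ) / q < (p : ℝ)) := by
    refine Finset.filter_congr fun p _ => ?_
    rw [div_lt_iff₀ hq0]
    constructor
    · intro hlt
      have h' : ((x : ℕ) : ℝ) < ((q * p : ℕ) : ℝ) := by exact_mod_cast hlt
      push_cast at h'
      linarith
    · intro hlt
      have h' : (x : ℝ) < (q : ℝ) * p := by linarith
      exact_mod_cast h'
  rw [hset]
  refine h.trans ?_
  have hlogq : 0 ≤ Real.log q := Real.log_natCast_nonneg q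
  have hlogx : 0 < Real.log x := Real.log_pos (by exact_mod_cast hx1)
  have h2 : 2 * Real.log q ≤ Real.log x := by
    have hqq : Real.log ((q : ℝ) * q) ≤ Real.log x :=
      Real.log_le_log (mul_pos hq0 hq0) (by exact_mod_cast hqx)
    rw [Real.log_mul hq0.ne' hq0.ne'] at hqq
    linarith
  rw [Real.log_div hx0.ne' hq0.ne']
  exact log_sub_log_add_div_le hlogq h2 hlogx

/-- The prime block of the inner sum: for naturals `2 ≤ q`, `q² ≤ x`,
`Σ_{p' ≤ x prime, qp' > x} 1/(qp') ≤ h(q) := (2 log q + 32)/(q log x)`. [folklore] -/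
private theorem inner_primes_le {x q : ℕ} (hq : 2 ≤ q) (hqx : q * q ≤ x) :
    ∑ q' ∈ (Nat.primesLE x).filter (fun q' => x < q * q'), (1 : ℝ) / ((q : ℝ) * (q' : ℝ)) ≤
      (q : ℝ)⁻¹ * ((2 * Real.log q + 32) / Real.log x) := by
  have e : ∀ q' ∈ (Nat.primesLE x).filter (fun q' => x < q * q'),
      (1 : ℝ) / ((q : ℝ) * (q' : ℝ)) = (q : ℝ)⁻¹ * (q' : ℝ)⁻¹ := by
    intro q' _
    rw [one_div, mul_inv]
  rw [Finset.sum_congr rfl e, ← Finset.mul_sum]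
  exact mul_le_mul_of_nonneg_left (sum_inv_primes_window_le hq hqx) (by positivity)

/-- The weight `h(q) = (2 log q + 32)/(q L)` satisfies `h(p²) ≤ h(p)` for `p ≥ 2`, `L > 0`
(`4 log p + 32 ≤ p (2 log p + 32)`). [folklore] -/
private theorem weight_sq_le {p : ℕ} (hp : 2 ≤ p) {L : ℝ} (hL : 0 < L) :
    (((p ^ 2 : ℕ) : ℝ))⁻¹ * ((2 * Real.log ((p ^ 2 : ℕ) : ℝ) + 32) / L) ≤
      ((p : ℝ))⁻¹ * ((2 * Real.log p + 32) / L) := by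
  have hp0 : (0 : ℝ) < p := by exact_mod_cast (show 0 < p by omega)
  have hp2 : (2 : ℝ) ≤ p := by exact_mod_cast hp
  have hl : 0 ≤ Real.log p := Real.log_natCast_nonneg p
  have hlog : Real.log ((p ^ 2 : ℕ) : ℝ) = 2 * Real.log p := by
    push_cast
    rw [Real.log_pow]
    norm_num
  rw [hlog]
  have hkey : (2 * (2 * Real.log p) + 32) / (p : ℝ) ≤ 2 * Real.log p + 32 := by
    rw [div_le_iff₀ hp0]
    nlinarith
  calc (((p ^ 2 : ℕ) : ℝ))⁻¹ * ((2 * (2 * Real.log p) + 32) / L)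
      = ((p : ℝ))⁻¹ * (((2 * (2 * Real.log p) + 32) / (p : ℝ)) / L) := by
        push_cast
        field_simp
    _ ≤ ((p : ℝ))⁻¹ * ((2 * Real.log p + 32) / L) := by
        gcongr

/-- Mertens I and II, upper halves (`MertensElementary`): for naturals `2 ≤ s ≤ x`,
`Σ_{p ≤ s} (2 log p + 32)/(p log x) ≤ (2 (log s + log 4) + 32 (log log s + 4))/log x ≤ 294`
(`log s, log log s ≤ log x`, `log 4 ≤ 2 log x`, `log x ≥ log 2 > 1/2`). [folklore] -/
private theorem sum_weight_primesLE_le {s x : ℕ} (hs : 2 ≤ s) (hsx : s ≤ x) :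
    ∑ p ∈ Nat.primesLE s, (p : ℝ)⁻¹ * ((2 * Real.log p + 32) / Real.log x) ≤ 294 := by
  have hx2 : (2 : ℝ) ≤ x := by exact_mod_cast hs.trans hsx
  have hs0 : (0 : ℝ) < s := by exact_mod_cast (show 0 < s by omega)
  have hlog2 : (1 : ℝ) / 2 < Real.log 2 := by
    have := Real.log_two_gt_d9
    linarith
  have hlogx2 : Real.log 2 ≤ Real.log x := Real.log_le_log two_pos hx2
  set L := Real.log x with hL
  have hLpos : 0 < L := by linarith
  have hlogs : Real.log s ≤ L := Real.log_le_log hs0 (by exact_mod_cast hsx)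
  have hloglogs : Real.log (Real.log s) ≤ L :=
    (Real.log_le_self (Real.log_natCast_nonneg s)).trans hlogs
  have hlog4 : Real.log 4 ≤ 2 * L := by
    have h4 : Real.log 4 = 2 * Real.log 2 := by
      rw [show (4 : ℝ) = 2 ^ 2 by norm_num, Real.log_pow]
      norm_num
    linarith
  have hM1 := Literature.NumberTheory.LFunctions.MertensBound.sum_log_div_prime_le s
  have hM2 := Literature.NumberTheory.LFunctions.MertensBound.sum_inv_prime_le s hs
  have e : ∀ p ∈ Nat.primesLE s, (p : ℝ)⁻¹ * ((2 * Real.log p + 32) / L) =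
      L⁻¹ * (2 * (Real.log p / p) + 32 * (1 / p)) := by
    intro p _
    ring
  rw [Finset.sum_congr rfl e, ← Finset.mul_sum, Finset.sum_add_distrib, ← Finset.mul_sum,
    ← Finset.mul_sum]
  have hLinv : L⁻¹ ≤ 2 := by
    rw [inv_le_comm₀ hLpos two_pos]
    linarith
  calc L⁻¹ * (2 * ∑ p ∈ Nat.primesLE s, Real.log p / p + 32 * ∑ p ∈ Nat.primesLE s, (1 : ℝ) / p)
      ≤ L⁻¹ * (2 * (Real.log s + Real.log 4) + 32 * (Real.log (Real.log s) + 4)) := by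
        gcongr
    _ ≤ L⁻¹ * (38 * L + 128) := by
        gcongr L⁻¹ * ?_
        linarith
    _ = 38 + 128 * L⁻¹ := by
        field_simp
    _ ≤ 38 + 128 * 2 := by gcongr
    _ = 294 := by norm_num

/-- The prime block of the outer sum: for naturals `s ≤ x`, `2 ≤ x`,
`Σ_{q ∈ PP(s)} h(q) ≤ 588` (`h(p²) ≤ h(p)` folds the prime squares onto the primes, then
`sum_weight_primesLE_le` twice). [folklore] -/
private theorem sum_weight_union_le {s x : ℕ} (hx : 2 ≤ x) (hsx : s ≤ x) :
    ∑ q ∈ Nat.primesLE s ∪ ((Nat.primesLE s).filter (fun p => p ^ 2 ≤ s)).image (fun p => p ^ 2),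
      ((q : ℕ) : ℝ)⁻¹ * ((2 * Real.log (q : ℕ) + 32) / Real.log x) ≤ 588 := by
  by_cases hs : 2 ≤ s
  · have hL : 0 < Real.log x := Real.log_pos (by exact_mod_cast (show 1 < x by omega))
    have hnn : ∀ q : ℕ, 0 ≤ (q : ℝ)⁻¹ * ((2 * Real.log q + 32) / Real.log x) := fun q => by
      have := Real.log_natCast_nonneg q
      positivity
    have h1 := sum_weight_primesLE_le hs hsx
    have h2 : ∑ q ∈ ((Nat.primesLE s).filter (fun p => p ^ 2 ≤ s)).image (fun p => p ^ 2),
        ((q : ℕ) : ℝ)⁻¹ * ((2 * Real.log (q : ℕ) + 32) / Real.log x) ≤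
        ∑ p ∈ Nat.primesLE s, (p : ℝ)⁻¹ * ((2 * Real.log p + 32) / Real.log x) := by
      calc ∑ q ∈ ((Nat.primesLE s).filter (fun p => p ^ 2 ≤ s)).image (fun p => p ^ 2),
            ((q : ℕ) : ℝ)⁻¹ * ((2 * Real.log (q : ℕ) + 32) / Real.log x)
          ≤ ∑ p ∈ (Nat.primesLE s).filter (fun p => p ^ 2 ≤ s),
              (((p ^ 2 : ℕ) : ℝ))⁻¹ * ((2 * Real.log ((p ^ 2 : ℕ) : ℝ) + 32) / Real.log x) :=
            Finset.sum_image_le_of_nonneg fun u _ => hnn u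
        _ ≤ ∑ p ∈ (Nat.primesLE s).filter (fun p => p ^ 2 ≤ s),
              (p : ℝ)⁻¹ * ((2 * Real.log p + 32) / Real.log x) :=
            Finset.sum_le_sum fun p hp =>
              weight_sq_le (Nat.mem_primesLE.1 (Finset.mem_filter.1 hp).1).2.two_le hL
        _ ≤ ∑ p ∈ Nat.primesLE s, (p : ℝ)⁻¹ * ((2 * Real.log p + 32) / Real.log x) :=
            Finset.sum_le_sum_of_subset_of_nonneg (Finset.filter_subset _ _) fun p _ _ => hnn p
    calc ∑ q ∈ Nat.primesLE s ∪ ((Nat.primesLE s).filter (fun p => p ^ 2 ≤ s)).image (fun p => p ^ 2),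
          ((q : ℕ) : ℝ)⁻¹ * ((2 * Real.log (q : ℕ) + 32) / Real.log x)
        ≤ ∑ q ∈ Nat.primesLE s, ((q : ℕ) : ℝ)⁻¹ * ((2 * Real.log (q : ℕ) + 32) / Real.log x) +
            ∑ q ∈ ((Nat.primesLE s).filter (fun p => p ^ 2 ≤ s)).image (fun p => p ^ 2),
              ((q : ℕ) : ℝ)⁻¹ * ((2 * Real.log (q : ℕ) + 32) / Real.log x) := sum_union_le_add hnn
      _ ≤ 294 + 294 := add_le_add h1 (h2.trans h1)
      _ = 588 := by norm_num
  · have hempty : Nat.primesLE s = ∅ := by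
      interval_cases s <;> simp
    simp [hempty]

/-- The prime-square block: if `#P ≤ 2(⌊√x⌋ + 1)` and `#Q ≤ ⌊√x⌋ + 1` (`x ≥ 1`), then
`Σ_{q ∈ P} Σ_{q' ∈ Q, qq' > x} 1/(qq') ≤ 8`: each term is `≤ 1/x` and
`2(⌊√x⌋ + 1)² ≤ 8x`. [folklore] -/
private theorem far_squares_le {x : ℕ} (hx : 1 ≤ x) {P Q : Finset ℕ}
    (hP : #P ≤ 2 * (Nat.sqrt x + 1)) (hQ : #Q ≤ Nat.sqrt x + 1) :
    ∑ q ∈ P, ∑ q' ∈ Q.filter (fun q' => x < q * q'), (1 : ℝ) / ((q : ℝ) * (q' : ℝ)) ≤ 8 := by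
  have hx0 : (0 : ℝ) < x := by exact_mod_cast hx
  have hs1 : 1 ≤ Nat.sqrt x := Nat.le_sqrt.2 (by simpa using hx)
  have hss : Nat.sqrt x * Nat.sqrt x ≤ x := Nat.sqrt_le x
  have hcount : 2 * (Nat.sqrt x + 1) * (Nat.sqrt x + 1) ≤ 8 * x := by nlinarith
  have hterm : ∀ q ∈ P, ∑ q' ∈ Q.filter (fun q' => x < q * q'), (1 : ℝ) / ((q : ℝ) * (q' : ℝ)) ≤
      ((Nat.sqrt x + 1 : ℕ) : ℝ) * (1 / (x : ℝ)) := by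
    intro q _
    calc ∑ q' ∈ Q.filter (fun q' => x < q * q'), (1 : ℝ) / ((q : ℝ) * (q' : ℝ))
        ≤ #(Q.filter (fun q' => x < q * q')) • (1 / (x : ℝ)) := by
          refine Finset.sum_le_card_nsmul _ _ _ fun q' hq' => ?_
          have hlt : x < q * q' := (Finset.mem_filter.1 hq').2
          have hle : (x : ℝ) ≤ (q : ℝ) * (q' : ℝ) := by exact_mod_cast hlt.le
          exact one_div_le_one_div_of_le hx0 hle
      _ = (#(Q.filter (fun q' => x < q * q')) : ℝ) * (1 / (x : ℝ)) := nsmul_eq_mul _ _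
      _ ≤ ((Nat.sqrt x + 1 : ℕ) : ℝ) * (1 / (x : ℝ)) := by
          gcongr
          exact_mod_cast (Finset.card_filter_le _ _).trans hQ
  calc ∑ q ∈ P, ∑ q' ∈ Q.filter (fun q' => x < q * q'), (1 : ℝ) / ((q : ℝ) * (q' : ℝ))
      ≤ ∑ q ∈ P, ((Nat.sqrt x + 1 : ℕ) : ℝ) * (1 / (x : ℝ)) := Finset.sum_le_sum hterm
    _ = (#P : ℝ) * (((Nat.sqrt x + 1 : ℕ) : ℝ) * (1 / (x : ℝ))) := by
        rw [Finset.sum_const, nsmul_eq_mul]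
    _ ≤ ((2 * (Nat.sqrt x + 1) : ℕ) : ℝ) * (((Nat.sqrt x + 1 : ℕ) : ℝ) * (1 / (x : ℝ))) := by
        gcongr
    _ = ((2 * (Nat.sqrt x + 1) * (Nat.sqrt x + 1) : ℕ) : ℝ) / x := by
        push_cast
        ring
    _ ≤ ((8 * x : ℕ) : ℝ) / x := div_le_div_of_nonneg_right (by exact_mod_cast hcount) hx0.le
    _ = 8 := by
        push_cast
        rw [mul_div_assoc, div_self hx0.ne', mul_one]

/-- **Stub S2 (prime-pair tail).** `Σ_{q ∈ PP(⌊√x⌋)} Σ_{q' ∈ PP(x), qq' > x} 1/(qq') ≤ C` for all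
`x ≥ 2` (`PP(z)` = primes `≤ z` and prime squares `≤ z`): the hyperbola region beyond `qq' = x` carries
bounded harmonic mass (Mertens' second theorem with rate: `Σ_{x/q < p ≤ x} 1/p ≪ (log q + 1)/log x` for
`q ≤ √x`, then Mertens' first theorem; the prime-square `q'` are handled by counting).  Here
`C = 596`. [folklore] -/
theorem stub_primePairTail :
    ∃ C : ℝ, ∀ x : ℕ, 2 ≤ x →
      ∑ q ∈ Nat.primesLE (Nat.sqrt x) ∪
          ((Nat.primesLE (Nat.sqrt x)).filter (fun p => p ^ 2 ≤ Nat.sqrt x)).image (fun p => p ^ 2),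
        ∑ q' ∈ (Nat.primesLE x ∪ ((Nat.primesLE x).filter (fun p => p ^ 2 ≤ x)).image (fun p => p ^ 2)).filter
            (fun q' => x < q * q'),
          (1 : ℝ) / ((q : ℝ) * (q' : ℝ)) ≤ C := by
  refine ⟨596, fun x hx => ?_⟩
  have hss : Nat.sqrt x * Nat.sqrt x ≤ x := Nat.sqrt_le x
  -- every `q ∈ PP(⌊√x⌋)` satisfies `2 ≤ q` and `q² ≤ x`
  have hmem : ∀ q ∈ Nat.primesLE (Nat.sqrt x) ∪
      ((Nat.primesLE (Nat.sqrt x)).filter (fun p => p ^ 2 ≤ Nat.sqrt x)).image (fun p => p ^ 2),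
      2 ≤ q ∧ q * q ≤ x := by
    intro q hq
    rcases Finset.mem_union.1 hq with h | h
    · have h' := Nat.mem_primesLE.1 h
      exact ⟨h'.2.two_le, (Nat.mul_le_mul h'.1 h'.1).trans hss⟩
    · obtain ⟨p, hp, rfl⟩ := Finset.mem_image.1 h
      have hp' := Finset.mem_filter.1 hp
      have hp2 := (Nat.mem_primesLE.1 hp'.1).2.two_le
      exact ⟨le_trans hp2 (by nlinarith), (Nat.mul_le_mul hp'.2 hp'.2).trans hss⟩
  -- cardinalities for the counting bound
  have hP1 : #(Nat.primesLE (Nat.sqrt x)) ≤ Nat.sqrt x + 1 := by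
    rw [Nat.primesLE_eq_filter_range]
    exact (Finset.card_filter_le _ _).trans (Finset.card_range _).le
  have hP : #(Nat.primesLE (Nat.sqrt x) ∪
      ((Nat.primesLE (Nat.sqrt x)).filter (fun p => p ^ 2 ≤ Nat.sqrt x)).image (fun p => p ^ 2)) ≤
      2 * (Nat.sqrt x + 1) := by
    refine (Finset.card_union_le _ _).trans ?_
    have h2 : #(((Nat.primesLE (Nat.sqrt x)).filter (fun p => p ^ 2 ≤ Nat.sqrt x)).image
        (fun p => p ^ 2)) ≤ Nat.sqrt x + 1 :=
      Finset.card_image_le.trans ((Finset.card_filter_le _ _).trans hP1)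
    omega
  have hQ : #(((Nat.primesLE x).filter (fun p => p ^ 2 ≤ x)).image (fun p => p ^ 2)) ≤
      Nat.sqrt x + 1 := by
    refine Finset.card_image_le.trans ?_
    have hsub : (Nat.primesLE x).filter (fun p => p ^ 2 ≤ x) ⊆ Finset.range (Nat.sqrt x + 1) := by
      intro p hp
      rw [Finset.mem_range, Nat.lt_succ_iff, Nat.le_sqrt']
      exact (Finset.mem_filter.1 hp).2
    exact (Finset.card_le_card hsub).trans (Finset.card_range _).le
  have nonneg : ∀ q q' : ℕ, (0 : ℝ) ≤ 1 / ((q : ℝ) * (q' : ℝ)) := fun q q' => by positivity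
  calc ∑ q ∈ Nat.primesLE (Nat.sqrt x) ∪
          ((Nat.primesLE (Nat.sqrt x)).filter (fun p => p ^ 2 ≤ Nat.sqrt x)).image (fun p => p ^ 2),
        ∑ q' ∈ (Nat.primesLE x ∪ ((Nat.primesLE x).filter (fun p => p ^ 2 ≤ x)).image
            (fun p => p ^ 2)).filter (fun q' => x < q * q'),
          (1 : ℝ) / ((q : ℝ) * (q' : ℝ))
      ≤ ∑ q ∈ Nat.primesLE (Nat.sqrt x) ∪
          ((Nat.primesLE (Nat.sqrt x)).filter (fun p => p ^ 2 ≤ Nat.sqrt x)).image (fun p => p ^ 2),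
          (∑ q' ∈ (Nat.primesLE x).filter (fun q' => x < q * q'), (1 : ℝ) / ((q : ℝ) * (q' : ℝ)) +
            ∑ q' ∈ (((Nat.primesLE x).filter (fun p => p ^ 2 ≤ x)).image (fun p => p ^ 2)).filter
              (fun q' => x < q * q'), (1 : ℝ) / ((q : ℝ) * (q' : ℝ))) := by
        refine Finset.sum_le_sum fun q _ => ?_
        rw [Finset.filter_union]
        exact sum_union_le_add fun _ => nonneg _ _
    _ = ∑ q ∈ Nat.primesLE (Nat.sqrt x) ∪
          ((Nat.primesLE (Nat.sqrt x)).filter (fun p => p ^ 2 ≤ Nat.sqrt x)).image (fun p => p ^ 2),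
          ∑ q' ∈ (Nat.primesLE x).filter (fun q' => x < q * q'), (1 : ℝ) / ((q : ℝ) * (q' : ℝ)) +
        ∑ q ∈ Nat.primesLE (Nat.sqrt x) ∪
          ((Nat.primesLE (Nat.sqrt x)).filter (fun p => p ^ 2 ≤ Nat.sqrt x)).image (fun p => p ^ 2),
          ∑ q' ∈ (((Nat.primesLE x).filter (fun p => p ^ 2 ≤ x)).image (fun p => p ^ 2)).filter
              (fun q' => x < q * q'), (1 : ℝ) / ((q : ℝ) * (q' : ℝ)) := Finset.sum_add_distrib
    _ ≤ 588 + 8 := by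
        refine add_le_add ?_ (far_squares_le (by omega) hP hQ)
        exact (Finset.sum_le_sum fun q hq => inner_primes_le (hmem q hq).1 (hmem q hq).2).trans
          (sum_weight_union_le hx (Nat.sqrt_le_self x))
    _ = 596 := by norm_num

end Summit.Parity.BatemanHorn.Cruxes.SystemMomentDeficit.Ideator3Sketch
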